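import Summits.HodgeConjecture.HodgeConjecture.Theorems.MarkmanPartnerTransportIsometrySpannedThirdOfGraphClasses
import Summits.HodgeConjecture.HodgeConjecture.Theses.MarkmanPartnerTransport

/-!
# Route MarkmanPartnerTransport · support #3 `IsometrySpannedThird` (stmt-HodgeConjecture-19651) BY NAME,
# at every Picard rank, modulo the graph classes `c_g` and three published facts

`hodgeConjectureFor_of_spannedByIsometries_of_graphClasses` (`…IsometrySpannedThirdOfGraphClasses`) read in
the route's own binders: the item `IsometrySpannedThird` — for every marked smooth projective `K3^{[2]}`-type
fourfold, `SpannedByIsometries X φ → HodgeConjectureFor 4 X` — follows from the geometric input `Graph`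
(for each marked `X` and each bijective rational Hodge `q`-isometry `g` of `H²(X)` an algebraic `c_g ∈ A²(X)`
with `(c_g ∪ y) ∪ w = (t·q(y,w) + q(gy,w) + q(gw,y))·P`; intended source `Δ^*(Γ_g ∘ q⁻¹)`, Markman 2024 +
Charles–Markman 2013) and {`VerbitskyGuan_cohomology_K3HilbertSquareType`, `OGrady2008_dualBBFClass_algebraic`,
`Voisin2003_cupProduct_algebraicClasses`}. No Picard-rank hypothesis, no K3 partner, no period surjectivity.
Together with `isometrySpannedThird_of_four_le` (ρ(X) ≥ 4, via partners) this pins the item's remaining debt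
to `Graph` at `ρ(X) ≤ 3`.

* `isometrySpannedThird_of_graphClasses` — (three facts) → `Graph` for all marked `X` → `IsometrySpannedThird`.

CONDITIONAL; credits nothing. No definition, no sorry.
-/

noncomputable section

set_option linter.dupNamespace false

open Module CategoryTheory
open Literature.AlgebraicTopology.SingularHomology Literature.Geometry.Kaehler
open Literature.AlgebraicGeometry Literature.AlgebraicGeometry.Motives Literature.AlgebraicGeometry.HodgeTheory
open Literature.AlgebraicGeometry.Hyperkaehler Literature.AlgebraicGeometry.Surfaces
open Summit.HodgeConjecture.HodgeConjecture.Theorems.NikulinTwinTransport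
open Summit.HodgeConjecture.HodgeConjecture.Theorems.MarkmanPartnerTransport.BBFPositivity

namespace Summit.HodgeConjecture.HodgeConjecture.Theorems.MarkmanPartnerTransport.PartnerLattice

/-- `MarkedK3Sq[X, φ, P, z]`: VERBATIM the `let MarkedK3Sq := …` binder of the route declarations of
MarkmanPartnerTransport (clauses (m1)–(m6)). Local notation only. -/
local notation3 (prettyPrint := false) "MarkedK3Sq[" X ", " φ ", " P ", " z "]" =>
  (((IsIntegralClass P ∧ ∀ Q : complexBetti X (2 * 4), IsIntegralClass Q → ∃ n : ℤ, Q = n • P) ∧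
    (∀ c : complexBetti X 2, IsIntegralClass c ↔ ∃ v : K3HilbertIndex → ℤ, φ c = fun i => (v i : ℂ)) ∧
    (∀ a : complexBetti X 2, cupPowTwo a 4 = ((3 : ℂ) * (k3HilbertForm 2 (φ a) (φ a)) ^ 2) • P) ∧
    (IsOfHodgeType 4 X 2 2 0 (LinearEquiv.symm φ z) ∧
      ∀ τ : complexBetti X 2, IsOfHodgeType 4 X 2 2 0 τ → ∃ t : ℂ, τ = t • LinearEquiv.symm φ z) ∧
    (∀ c : complexBetti X 2, IsOfHodgeType 4 X 2 1 1 c ↔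
      (k3HilbertForm 2 (φ c) z = 0 ∧ k3HilbertForm 2 (φ c) (star z) = 0)) ∧
    (k3HilbertForm 2 z z = 0 ∧ 0 < (k3HilbertForm 2 (star z) z).re)))

/-- `Cup3[c, y, w] = (c ∪ y) ∪ w ∈ H⁸` for `c ∈ H⁴`, `y, w ∈ H²`. Local notation only. -/
local notation3 (prettyPrint := false) "Cup3[" c ", " y ", " w "]" =>
  cupProduct (rfl : 2 * 3 + 2 = 2 * 4) (cupProduct (rfl : 2 * 2 + 2 = 2 * 3) c y) w

variable {X : SchemeOver ℂ} {φ : complexBetti X 2 ≃ₗ[ℂ] (K3HilbertIndex → ℂ)} {P : complexBetti X (2 * 4)}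
  {z : K3HilbertIndex → ℂ}

/-- `Graph[X, φ, P]`: the geometric input — for every bijective rational Hodge `q`-isometry `g` of `H²(X)` an
ALGEBRAIC class `c_g ∈ A²(X)` and `t ∈ ℂ` with `(c_g ∪ y) ∪ w = (t·q(y,w) + q(gy,w) + q(gw,y))·P`
(intended: `c_g = Δ^*(Γ_g ∘ q⁻¹)`, `t = tr g`; Markman 2024 + Charles–Markman 2013). Local notation only. -/
local notation3 (prettyPrint := false) "Graph[" X ", " φ ", " P "]" =>
  ∀ g : complexBetti X 2 →ₗ[ℂ] complexBetti X 2, Function.Bijective g →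
    (∀ y, IsRationalClass y → IsRationalClass (g y)) →
    (∀ (a b : ℕ) y, IsOfHodgeType 4 X 2 a b y → IsOfHodgeType 4 X 2 a b (g y)) →
    (∀ a b, k3HilbertForm 2 (φ (g a)) (φ (g b)) = k3HilbertForm 2 (φ a) (φ b)) →
    ∃ cg ∈ algebraicClasses X 2, ∃ t : ℂ, ∀ y w : complexBetti X 2,
      Cup3[cg, y, w] = (t * k3HilbertForm 2 (φ y) (φ w) + k3HilbertForm 2 (φ (g y)) (φ w) +
        k3HilbertForm 2 (φ (g w)) (φ y)) • P

/-- **`IsometrySpannedThird` by name from the graph classes** (module docstring).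
[cite: Markman2024, §1.1 Thm. 1.1] [cite: Zarhin1983HodgeGroupsK3, Thm. 1.5.1]
[cite: Novario2026HodgeClassesHilbertSquares, Thm. 6.2] -/
theorem isometrySpannedThird_of_graphClasses
    (hV : VerbitskyGuan_cohomology_K3HilbertSquareType) (hO : OGrady2008_dualBBFClass_algebraic)
    (hcup : Voisin2003_cupProduct_algebraicClasses)
    (hGraph : ∀ (X : SchemeOver ℂ), IsSmoothProjective 4 X → IsOfK3HilbertSquareType X →
      ∀ (φ : complexBetti X 2 ≃ₗ[ℂ] (K3HilbertIndex → ℂ)) (P : complexBetti X (2 * 4)) (z : K3HilbertIndex → ℂ),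
      MarkedK3Sq[X, φ, P, z] → Graph[X, φ, P]) :
    Summit.HodgeConjecture.HodgeConjecture.Theses.MarkmanPartnerTransport.IsometrySpannedThird := by
  delta Summit.HodgeConjecture.HodgeConjecture.Theses.MarkmanPartnerTransport.IsometrySpannedThird
  intro _ _ _ X hX hK φ P z hM hSp
  exact hodgeConjectureFor_of_spannedByIsometries_of_graphClasses hV hO hcup hX hK hM hSp
    (hGraph X hX hK φ P z hM)

end Summit.HodgeConjecture.HodgeConjecture.Theorems.MarkmanPartnerTransport.PartnerLattice

end
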